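import Literature.NumberTheory.LFunctions.WeilBochnerRepresentation
import Literature.NumberTheory.LFunctions.WeilSquareMollifier
import Literature.NumberTheory.LFunctions.WeilExplicitApproxIdentity
import Literature.NumberTheory.LFunctions.ExplicitFormulaPsiOne
import Summits.RiemannHypothesis.RiemannHypothesis.Theorems.SpectralTraceWindowTraceArchStubCountingLawAux
import HarnessLib

/-!
# RiemannHypothesis — the Bochner–Kreĭn measure of a window integrates band-limited kernels

Helper file (`--supports stmt-RiemannHypothesis-0098`), RH-free, standard axioms.  Seat rh-explicit
weil-3 (structure).

Let `μ` be ANY positive measure on `ℝ` representing Weil's form on the window `[-b, b]`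
(`‖ĝ(½+it)‖² ∈ L¹(μ)` and `W(g ⋆ g̃) = ∫ ‖ĝ(½+it)‖² dμ` for all smooth tests `g` supported in
`[-b, b]`: hypothesis `hμ`, literally the conclusion of
`Literature.NumberTheory.LFunctions.WeilBochner.exists_measure_of_weilPositivityOn`).  The
representation was proved for SMOOTH squares; the counting law of the next file tests `μ` against
Selberg's band-limited majorant and minorant of an interval, whose prime-side kernels are merely
CONTINUOUS.  This file supplies the extension:

* `integrable_arch_of_decay`: a continuous compactly supported kernel `k` with
  `‖k̂(½+iu)‖ ≤ M/(1+u²)` has an integrable archimedean integrand `k̂(½+it) Re ψ(¼+it/2)`;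
* **`weilFunctional_kernel_eq_integral`**: if moreover `tsupport k ⊆ [-a, a]` with `a < 2b` and
  `k̂(½+iu)` is a nonnegative real for every real `u`, then `k̂(½+i·) ∈ L¹(μ)` and
  `W(k) = ∫ k̂(½+it) dμ(t)`.

Proof: smooth `k` by the square mollifiers `ν_n = φ_n ⋆ φ̃_n` of `WeilSquareMollifier.lean`
(`(k ⋆ ν_n)^ = k̂ · |φ̂_n|²`, a nonnegative real, support enlarged by `2/(n+1)`); by the Boas–Kac
factorisation (`WeilBochner.exists_sq_eq_of_weilMellin_nonneg`) `k ⋆ ν_n = ψ_n ⋆ ψ̃_n` with `ψ_n`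
smooth supported in `[-b, b]`, so `hμ` gives `W(k ⋆ ν_n) = ∫ k̂ |φ̂_n|² dμ`; let `n → ∞`
(`WeilApproxIdentity.tendsto_weilFunctional` on the Weil side; Fatou and dominated convergence on the
measure side, `|φ̂_n|² ↑→ 1` pointwise with `|φ̂_n| ≤ 1`).
-/

noncomputable section

set_option linter.dupNamespace false  -- the mandated namespace repeats `RiemannHypothesis`

open Complex Filter Set MeasureTheory
open scoped Real Topology ContDiff ComplexConjugate
open Literature.NumberTheory.LFunctions Literature.NumberTheory.LFunctions.WeilContinuous
  Literature.NumberTheory.LFunctions.WeilSquareMollifier Literature.Analysis.SpecialFunctions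

namespace Summit.RiemannHypothesis.RiemannHypothesis.Theorems.WeilBochnerMeasure

variable {b : ℝ} {μ : Measure ℝ}

/-! ## Integrability of the archimedean integrand from quadratic decay -/

/-- A continuous compactly supported kernel whose transform decays like `M/(1+u²)` on the critical
line has an integrable archimedean integrand `t ↦ k̂(½+it) · Re ψ(¼+it/2)`
(`|Re ψ(¼+it/2)| ≤ 5 + log(1+|t|)` and `(A + 2 log(1+|t|))/(¼+t²) ∈ L¹`). -/
theorem integrable_arch_of_decay {k : ℝ → ℂ} (hkc : Continuous k) (hks : HasCompactSupport k)
    {M : ℝ} (hM : ∀ u : ℝ, ‖weilMellin k (1 / 2 + u * I)‖ ≤ M / (1 + u ^ 2)) :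
    Integrable fun t : ℝ ↦
      weilMellin k (1 / 2 + t * I) * ((Complex.digamma (1 / 4 + t / 2 * I)).re : ℂ) := by
  have hM0 : 0 ≤ M := by
    have h := (norm_nonneg _).trans (hM 0)
    simpa using h
  have hmeas : AEStronglyMeasurable (fun t : ℝ ↦
      weilMellin k (1 / 2 + t * I) * ((Complex.digamma (1 / 4 + t / 2 * I)).re : ℂ)) volume := by
    refine (((continuous_weilMellin hkc hks).comp (by fun_prop : Continuous fun t : ℝ ↦
      (1 / 2 : ℂ) + t * I)).mul ?_).aestronglyMeasurable
    exact continuous_ofReal.comp continuous_reDigammaQuarter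
  refine ((PsiOneExplicit.integrable_left_majorant (A := 5) (by norm_num)).const_mul M).mono' hmeas
    (ae_of_all _ fun t ↦ ?_)
  have hψ : |reDigammaQuarter t| ≤ 5 + Real.log (1 + |t|) :=
    SpectralTraceWindowTraceArch.stub_countingLaw_abs_reDigammaQuarter_le t
  have hlog : 0 ≤ Real.log (1 + |t|) := Real.log_nonneg (by linarith [abs_nonneg t])
  rw [norm_mul, Complex.norm_real, Real.norm_eq_abs]
  calc ‖weilMellin k (1 / 2 + t * I)‖ * |reDigammaQuarter t|
      ≤ M / (1 + t ^ 2) * (5 + Real.log (1 + |t|)) :=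
        mul_le_mul (hM t) hψ (abs_nonneg _) (by positivity)
    _ ≤ M * ((5 + 2 * Real.log (1 + |t|)) / (1 / 4 + t ^ 2)) := by
        rw [div_mul_eq_mul_div, mul_div_assoc]
        refine mul_le_mul_of_nonneg_left ?_ hM0
        rw [div_le_div_iff₀ (by positivity) (by positivity)]
        nlinarith [mul_nonneg hlog (sq_nonneg t)]

/-! ## The representation on continuous band-limited kernels with nonnegative transform -/

/-- **The Bochner–Kreĭn measure integrates continuous band-limited kernels.**  Let `μ` represent
Weil's form on `[-b, b]` (`b > 0`) and let `k` be a continuous kernel with `tsupport k ⊆ [-a, a]`,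
`a < 2b`, whose transform on the critical line is a nonnegative real with `‖k̂(½+iu)‖ ≤ M/(1+u²)`.
Then `t ↦ k̂(½+it)` is `μ`-integrable and `W(k) = ∫ k̂(½+it) dμ(t)`.  (Mollify by the square
mollifiers `ν_n = φ_n ⋆ φ̃_n`: `k ⋆ ν_n` is a smooth hermitian square `ψ_n ⋆ ψ̃_n` on the window by
Boas–Kac, `W(k ⋆ ν_n) = ∫ k̂ |φ̂_n|² dμ` by `hμ`, and `n → ∞`.) -/
theorem weilFunctional_kernel_eq_integral (hb : 0 < b)
    (hμ : ∀ g : ℝ → ℂ, IsWeilTest g → tsupport g ⊆ Icc (-b) b →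
      Integrable (fun t : ℝ ↦ ‖weilMellin g (1 / 2 + t * I)‖ ^ 2) μ ∧
        weilQuadratic g = ((∫ t, ‖weilMellin g (1 / 2 + t * I)‖ ^ 2 ∂μ : ℝ) : ℂ))
    {k : ℝ → ℂ} (hkc : Continuous k) {a : ℝ} (ha : a < 2 * b) (hkt : tsupport k ⊆ Icc (-a) a)
    {M : ℝ} (hM : ∀ u : ℝ, ‖weilMellin k (1 / 2 + u * I)‖ ≤ M / (1 + u ^ 2))
    (hpos : ∀ u : ℝ, (weilMellin k (1 / 2 + u * I)).im = 0 ∧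
      0 ≤ (weilMellin k (1 / 2 + u * I)).re) :
    Integrable (fun t : ℝ ↦ (weilMellin k (1 / 2 + t * I)).re) μ ∧
      weilFunctional k = ((∫ t, (weilMellin k (1 / 2 + t * I)).re ∂μ : ℝ) : ℂ) := by
  have hks : HasCompactSupport k := isCompact_Icc.of_isClosed_subset (isClosed_tsupport k) hkt
  -- the spectral density `F = Re k̂(½+it)` (`k̂` itself is real there)
  set F : ℝ → ℝ := fun t ↦ (weilMellin k (1 / 2 + t * I)).re with hF
  have hkF : ∀ t : ℝ, weilMellin k (1 / 2 + t * I) = (F t : ℂ) := fun t ↦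
    Complex.ext (by simp [hF]) (by rw [Complex.ofReal_im]; exact (hpos t).1)
  have hFc : Continuous F := by
    have h1 : Continuous fun t : ℝ ↦ (1 / 2 : ℂ) + t * I := by fun_prop
    exact Complex.continuous_re.comp ((continuous_weilMellin hkc hks).comp h1)
  have hF0 : ∀ t, 0 ≤ F t := fun t ↦ (hpos t).2
  -- the square mollifiers `ν n = φ_{n+1} ⋆ φ̃_{n+1}`, radius `δ n = 2/(n+2) ≤ 1`
  set ν : ℕ → ℝ → ℂ := fun n ↦ weilConv (moll (n + 1)) (weilReflect (moll (n + 1))) with hν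
  set δ : ℕ → ℝ := fun n ↦ 2 * (bump (n + 1)).rOut with hδ
  have hνc : ∀ n, Continuous (ν n) := fun n ↦ continuous_sqMoll (n + 1)
  have hνt : ∀ n, IsWeilTest (ν n) := fun n ↦ isWeilTest_sqMoll (n + 1)
  have hδ0 : Tendsto δ atTop (𝓝 0) := tendsto_two_mul_bump_rOut.comp (tendsto_add_atTop_nat 1)
  have hδeq : ∀ n, δ n = 2 / ((n : ℝ) + 2) := fun n ↦ by
    simp only [hδ]; rw [two_mul_bump_rOut]; push_cast; ring
  have hδpos : ∀ n, 0 < δ n := fun n ↦ by rw [hδeq]; positivity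
  have hδ1 : ∀ n, δ n ≤ 1 := fun n ↦ by
    rw [hδeq, div_le_one (by positivity)]
    have : (0 : ℝ) ≤ n := Nat.cast_nonneg n
    linarith
  have hνs : ∀ n x, δ n ≤ |x| → ν n x = 0 := fun n x hx ↦ sqMoll_eq_zero hx
  have hν1 : ∀ n, ∫ x, ν n x = 1 := fun n ↦ integral_sqMoll (n + 1)
  have hνn : ∀ n, ∫ x, ‖ν n x‖ = 1 := fun n ↦ integral_norm_sqMoll (n + 1)
  have hνcs : ∀ n, HasCompactSupport (ν n) := fun n ↦ (hνt n).2
  -- the weights `r n t = |φ̂_{n+1}(½+it)|² ∈ [0, 1]`, `→ 1`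
  set r : ℕ → ℝ → ℝ := fun n t ↦ Complex.normSq (weilMellin (moll (n + 1)) (1 / 2 + t * I)) with hr
  have hνline : ∀ n (t : ℝ), weilMellin (ν n) (1 / 2 + t * I) = (r n t : ℂ) := fun n t ↦
    weilMellin_sqMoll_half (n + 1) t
  have hr0 : ∀ n t, 0 ≤ r n t := fun n t ↦ Complex.normSq_nonneg _
  have hr1 : ∀ n t, r n t ≤ 1 := fun n t ↦ by
    simp only [hr]
    rw [Complex.normSq_eq_norm_sq]
    have h := norm_weilMellin_moll_half_le (n + 1) t
    nlinarith [norm_nonneg (weilMellin (moll (n + 1)) (1 / 2 + t * I))]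
  have hrlim : ∀ t, Tendsto (fun n ↦ r n t) atTop (𝓝 1) := fun t ↦ by
    have h := (tendsto_weilMellin_moll (1 / 2 + t * I)).comp (tendsto_add_atTop_nat 1)
    have h2 := (Complex.continuous_normSq.tendsto _).comp h
    simpa [hr, Function.comp_def] using h2
  have hrc : ∀ n, Continuous (r n) := fun n ↦ by
    have h1 : Continuous fun t : ℝ ↦ (1 / 2 : ℂ) + t * I := by fun_prop
    exact Complex.continuous_normSq.comp
      ((continuous_weilMellin (continuous_moll _) (hasCompactSupport_moll _)).comp h1)
  -- the smoothed kernels `G n = k ⋆ ν n`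
  set G : ℕ → ℝ → ℂ := fun n ↦ weilConv k (ν n) with hG
  have hGtest : ∀ n, IsWeilTest (G n) := fun n ↦ by
    refine ⟨?_, ?_⟩
    · simp only [hG]; rw [weilConv_eq_convolution_real]
      exact (hνcs n).contDiff_convolution_right (ContinuousLinearMap.mul ℝ ℂ)
        hkc.locallyIntegrable (hνt n).1
    · simp only [hG]; rw [weilConv_eq_convolution_real]
      exact HasCompactSupport.convolution (L := ContinuousLinearMap.mul ℝ ℂ) hks (hνcs n)
  have hGsupp : ∀ n, tsupport (G n) ⊆ Icc (-(a + δ n)) (a + δ n) := fun n ↦ by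
    refine (tsupport_weilConv_subset (h := ν n) hks).trans ?_
    rintro x ⟨u, hu, v, hv, rfl⟩
    have hu' := hkt hu
    have hv' := tsupport_sqMoll_subset (n + 1) hv
    simp only [mem_Icc] at hu' hv' ⊢
    constructor <;> linarith [hu'.1, hu'.2, hv'.1, hv'.2]
  have hGline : ∀ n (t : ℝ), weilMellin (G n) (1 / 2 + t * I) = ((F t * r n t : ℝ) : ℂ) := by
    intro n t
    simp only [hG]
    rw [weilMellin_weilConv_holds hkc hks (hνc n) (hνcs n), hνline n t, hkF t]
    push_cast; ring
  -- Weil side: `W(G n) → W(k)`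
  have hA := integrable_arch_of_decay hkc hks hM
  have hWlim : Tendsto (fun n ↦ weilFunctional (G n)) atTop (𝓝 (weilFunctional k)) :=
    WeilApproxIdentity.tendsto_weilFunctional hνc hδ0 hδ1 hνs hν1 hνn hkc hks hA
  -- measure side: for `n` large, `G n` lives on `[-2b, 2b]` and `W(G n) = ∫ F · r n dμ`
  have hev : ∀ᶠ n : ℕ in atTop, δ n ≤ 2 * b - a :=
    (tendsto_order.1 hδ0).2 _ (by linarith) |>.mono fun n hn ↦ hn.le
  have hrep : ∀ n, δ n ≤ 2 * b - a →
      Integrable (fun t ↦ F t * r n t) μ ∧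
        weilFunctional (G n) = ((∫ t, F t * r n t ∂μ : ℝ) : ℂ) := by
    intro n hn
    have hGs : tsupport (G n) ⊆ Icc (-(2 * b)) (2 * b) :=
      (hGsupp n).trans (Icc_subset_Icc (by linarith) (by linarith))
    obtain ⟨ψ, hψ, hψs, hψG⟩ := WeilBochner.exists_sq_eq_of_weilMellin_nonneg hb (hGtest n) hGs
      fun t ↦ by
        rw [hGline n t]
        exact ⟨by rw [Complex.ofReal_re]; exact mul_nonneg (hF0 t) (hr0 n t),
          Complex.ofReal_im _⟩
    obtain ⟨hψi, hψQ⟩ := hμ ψ hψ hψs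
    have hsq : ∀ t : ℝ, ‖weilMellin ψ (1 / 2 + t * I)‖ ^ 2 = F t * r n t := fun t ↦ by
      have h := weilMellin_weilConv_weilReflect_half hψ t
      rw [hψG, hGline n t] at h
      exact_mod_cast h.symm
    refine ⟨hψi.congr (ae_of_all _ fun t ↦ hsq t), ?_⟩
    have hQ : weilQuadratic ψ = weilFunctional (G n) := by rw [weilQuadratic, hψG]
    rw [← hQ, hψQ]
    congr 1
    exact integral_congr_ae (ae_of_all _ fun t ↦ hsq t)
  -- (1) `F ∈ L¹(μ)` by Fatou
  have hWre : Tendsto (fun n ↦ (weilFunctional (G n)).re) atTop (𝓝 (weilFunctional k).re) :=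
    (Complex.continuous_re.tendsto _).comp hWlim
  have hptT : ∀ t, Tendsto (fun n : ℕ ↦ F t * r n t) atTop (𝓝 (F t)) := fun t ↦ by
    simpa using (hrlim t).const_mul (F t)
  have hcF0 : ∀ n t, 0 ≤ F t * r n t := fun n t ↦ mul_nonneg (hF0 t) (hr0 n t)
  have hcFle : ∀ n t, F t * r n t ≤ F t := fun n t ↦ mul_le_of_le_one_right (hF0 t) (hr1 n t)
  have hcmeas : ∀ n, Measurable fun t ↦ ENNReal.ofReal (F t * r n t) := fun n ↦
    (hFc.mul (hrc n)).measurable.ennreal_ofReal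
  have hlint : ∫⁻ t, ENNReal.ofReal (F t) ∂μ ≤ ENNReal.ofReal ((weilFunctional k).re) := by
    calc ∫⁻ t, ENNReal.ofReal (F t) ∂μ
        = ∫⁻ t, liminf (fun n ↦ ENNReal.ofReal (F t * r n t)) atTop ∂μ := by
          refine lintegral_congr fun t ↦ ?_
          exact ((ENNReal.tendsto_ofReal (hptT t)).liminf_eq).symm
      _ ≤ liminf (fun n ↦ ∫⁻ t, ENNReal.ofReal (F t * r n t) ∂μ) atTop :=
          lintegral_liminf_le hcmeas
      _ = liminf (fun n ↦ ENNReal.ofReal ((weilFunctional (G n)).re)) atTop := by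
          refine liminf_congr (hev.mono fun n hn ↦ ?_)
          obtain ⟨hi, hW⟩ := hrep n hn
          rw [← ofReal_integral_eq_lintegral_ofReal hi (ae_of_all _ (hcF0 n)), hW,
            Complex.ofReal_re]
      _ = ENNReal.ofReal ((weilFunctional k).re) :=
          ((ENNReal.tendsto_ofReal hWre).liminf_eq)
  have hFint : Integrable F μ := by
    refine ⟨hFc.aestronglyMeasurable, ?_⟩
    rw [hasFiniteIntegral_iff_ofReal (ae_of_all _ hF0)]
    exact hlint.trans_lt ENNReal.ofReal_lt_top
  -- (2) dominated convergence `∫ F · r n dμ → ∫ F dμ`, and uniqueness of limits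
  have hlim : Tendsto (fun n ↦ ∫ t, F t * r n t ∂μ) atTop (𝓝 (∫ t, F t ∂μ)) :=
    tendsto_integral_of_dominated_convergence F
      (fun n ↦ (hFc.mul (hrc n)).aestronglyMeasurable) hFint
      (fun n ↦ ae_of_all _ fun t ↦ by
        rw [Real.norm_eq_abs, abs_of_nonneg (hcF0 n t)]
        exact hcFle n t)
      (ae_of_all _ hptT)
  have hlimC : Tendsto (fun n ↦ (((∫ t, F t * r n t ∂μ : ℝ)) : ℂ)) atTop
      (𝓝 (((∫ t, F t ∂μ : ℝ)) : ℂ)) :=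
    (Complex.continuous_ofReal.tendsto _).comp hlim
  have hWlim' : Tendsto (fun n ↦ (((∫ t, F t * r n t ∂μ : ℝ)) : ℂ)) atTop
      (𝓝 (weilFunctional k)) :=
    hWlim.congr' (hev.mono fun n hn ↦ (hrep n hn).2)
  exact ⟨hFint, tendsto_nhds_unique hWlim' hlimC⟩

end Summit.RiemannHypothesis.RiemannHypothesis.Theorems.WeilBochnerMeasure

end
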